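import Summits.QuantumFields.YangMills.Theorems.BalabanUVNodesN16HolderOfLeaf
import Summits.QuantumFields.YangMills.Theorems.BalabanUVNodesN16HolderShape
import HarnessLib

/-!
# Route «BalabanUVNodes», cluster K4 «SpineRates» — node N16 = NE3: THE YM-PLAN ROW DECL `T4EtaRateMin.NE3Shape` FROM NODE N05's LEAF AT ITS RESIDUAL
# HÖLDER EXPONENT (ANY `β ∈ [0,1]`) AND N07's INTERFACE, IN ONE THEOREM — the DECL column's deepest knit, with the (1.36) Hölder member AS PRINTED

Cell `pub-ymgap`, seat `pub-ymgap-dag-n16-c` (R134 fan-out seat, strategy s1; HUMAN RULING D-0062; chair R424 venue), generation 3, file 19 — module (H) of the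
located item «the Hölder-exponent pin of N16's N05-socket» (`HOME/pub-ymgap-dag-n16-c/LOCATED-N16-HOLDER-PIN.md`, LOCATED-2 «the row decl does not read the Hölder
exponent»); over file 14 `…N16HolderOfLeaf` (`n16_holder_of_leaf`, p480764), file 17 `…N16HolderShape` (`ne3Shape_of_covRootHolder`, p483903), g0's
`exists_window_print` and n16-a's `gradConst_four_pos`.  Theorems only (0 `def`, 0 sorry).  `--supports stmt-QuantumFields-19908` (helper).  `bears_on: R4∕N16 · YM-PLAN
§2 row N16 decl · edge N05 → N16`.

WHY.  n16-a's DECL column (`ne3Shape_of_inEdges` → `ne3Shape_of_thm4Output` → `…Landau138` → `…OutputPrint` ∕ `…TorusAt_print`) reaches the row's decl from the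
N05-side binders with the (1.36) Hölder member at `β₀ = 1` — unprinted ([Balaban1985RegularSpaces] p. 82 «β ≦ β₀ < 1»).  By LOCATED-2 the row's decl is
EXPONENT-BLIND.  THIS FILE draws the consequence in one theorem each: the row's decl `NE3Shape` (at Bałaban's readings over `sfClass`, n16-a's regime VERBATIM) from
node N05's leaf clauses `B8.Thm4Body ∧ B8.Prop3Body` on n05-a's family `zdGF3 (M_n ℂ) L β len` over the univ sub-index for ANY `β ∈ [0,1]` (§1), and from N05's
leaf-of-record SHAPE `B8LeafKnitRS.B8LeafRS` on that family (§2) — i.e. from what node N05's record ACTUALLY states (residual exponent `lam.β < 1`), plus N07's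
`LeafH3sup`.  No restatement of anything is needed for THIS face of N16: the located pin concerns only the (Lip₂′ᶜ) conjunct read by N19∕N21.

WHAT THIS FILE PROVES: §1 `ne3Shape_of_leaf_holder` — `∃ r > 0` (THE END's), then for Thm-4∕Prop-3 letters, the window at `c₁′`, the shape regime
`(ε, s₁, t, b, c, ε₁)` of `N16.ne3Shape_of_n16` (regularity letter `g := gradConst 4 c`, leaf letters `(b, c)`), the averaging letter `α`, the (3.35) schedule, the four
k-free letter lines, ANY `β ∈ [0,1]`: leaf clauses on `zdGF3 … L β len` → `dom ⊆ sfClass 4 L N ε₁ 0` → `LeafH3sup 4 L N ε b c dom` → (regular selection exists) ∧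
(∀ selection, `∃ C′ ≥ 0, NE3Shape (minActReadings …) C′ (L⁻¹)`) — `n16_holder_of_leaf` at `g := gradConst 4 c` ∘ `ne3Shape_of_covRootHolder`; §2 `ne3Shape_of_b8LeafRS_holder`
— the same from `B8LeafRS … (fun i ↦ zdGF3 (M_n ℂ) L β len i.1) …` (only `t4`, `p3` read; window threshold `c₁′` produced, g0's `exists_window_print`); §3 VACUITY
GUARD `covRootHolder_flatStratum` (the β-root on the flat stratum, any `β ≤ 1`) · `ne3Shape_covRootHolder_flatStratum` (file 17 applies there; n16-a's guard verbatim).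
HONEST FRAMING: composition of landed theorems by name; the leaf clauses ∕ leaf shape are node N05's theorems (in tree only modulo its sockets), (H3ˢᵘᵖ) is N07's
([Balaban1985Variational] Thm 1 (8)+(10) TYPE); nothing of Bałaban's proved; **N16 ∕ NE3 NOT discharged**; count-neutral; one finite four-torus at fixed ε — NOT
ℝ⁴, NOT infinite volume, NOT OS, NOT a mass gap, NOT Clay.
-/

set_option autoImplicit false

open scoped BigOperators Matrix Matrix.Norms.L2Operator
open NormedSpace

namespace Summit.QuantumFields.YangMills.BalabanUVNodes.N16HolderShapeOfLeaf

open Literature.MathematicalPhysics.QuantumFieldTheory.Balaban1983to89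
open B7Prop1Explicit B7Prop2Explicit
open B7Prop3Flat (c3)
open T4AveragingDeficitWall (fineAction blockSites)
open T4AveragingDeficitWallBoundary (IsPeriodicCfg periodBox)
open T4EtaRateMin (NE3Shape)
open B8LeafModelZd (ZdIdx)
open B8LeafModelZd3 (zdGF3)
open B8LeafKnitRS (B8LeafRS)
open Summit.QuantumFields.BalabanUV.T4Continuum
open MinimalActionWitness (flatCfg)
open NE3EnergyShapes (IsUnitarySite)
open MinimalActionSandwich (IsMinimiser)
open MinimalActionRate (sfClass minActReadings)
open MinimalActionRefine (RegularSup gradConst)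
open BlockAverageCurrent (curConst)
open NE3RightInverseSupLetters (frameC)
open NE3.LeafIndexSockets (LeafH3sup)
open Summit.QuantumFields.YangMills.BalabanUVNodes.N16HolderDefs (CovRootHolder covRootHolder_of_ne3EnergyRateWCov)
open Summit.QuantumFields.YangMills.BalabanUVNodes.N16HolderOfLeaf (n16_holder_of_leaf)
open Summit.QuantumFields.YangMills.BalabanUVNodes.N16HolderShape (ne3Shape_of_covRootHolder)
open Summit.QuantumFields.YangMills.BalabanUVNodes.N16 (gradConst_four_pos n16_flatStratum leafH3sup_flatStratum flatStratum_subset_sfClass_zero)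
open Summit.QuantumFields.YangMills.BalabanUVNodes.N16.OfLeaf (exists_window_print)

noncomputable section

section Matrices

variable {n : Type} [Fintype n] [DecidableEq n]

/-! ## §1 The row's decl from N05's leaf clauses on `zdGF3 (M_n ℂ) L β len`, any `β ∈ [0,1]` -/

/-- **N16 · THE ROW's DECL `NE3Shape` FROM THE [B8] LEAF ON THE UNIV SUB-FAMILY OF `zdGF3 (M_n(ℂ)) L β len` (ANY `β ∈ [0,1]`) AND N07's (H3ˢᵘᵖ)** (`d = 4`, `L ≥ 2`,
`N ≥ 1`; `𝔸 = M_n(ℂ)` with the `L²`-operator-norm C⋆-structure assembled in the statement): `∃ r > 0` (THE END's radius), then for all Thm-4∕Prop-3 letters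
`(c₁, c₁′, B₁′, cP, C₂, B₀β, inp)`, a length function `len ≥ 1` on its support with `len e_μ = 1`, `0 < B₁′`, `5·4·L·B₀ ≤ B₁′`, `16·(5·4·L·B₀)·c₁′ ≤ 1`, the window at
`c₁′`; the shape regime of `N16.ne3Shape_of_n16` VERBATIM (`0 < ε ≤ r`, `0 ≤ s₁ ≤ r`, radii `0 ≤ b ≤ t`, `0 < c ≤ t`, the numeral `2⁹¹L¹⁷t ≤ 1`, `2⁷⁶L¹²t ≤ ε`,
`16C₀ε ≤ 3`, `1024·5·8·L²ε ≤ 1`, `b ≤ ε∕2`, the `c`-line, `ε₁ ≤ ¼`, `ε₁ ≤ b`, `4ε₁ ≤ c`); the averaging letter `α` in its window with `ε < α`; the (3.35) schedule;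
the four k-free letter lines placing `B = 5·4·L·B₀`, `B_h = 5·4·L·B₀β` below `s₁`, `s₂`; ANY `β ∈ [0,1]`: `B8.Thm4Body c₁ B₁′` ∧ `B8.Prop3Body cP 4 L C₂ inp B₀β` on
`fun i ↦ zdGF3 (M_n ℂ) L β len i.1` → `dom ⊆ sfClass 4 L N ε₁ 0` → `LeafH3sup 4 L N ε b c dom` → (a regular selection exists) ∧ (∀ selection, `∃ C′ ≥ 0, NE3Shape
(minActReadings 4 (sfClass 4 L N ε) L N dom loc_D) C′ (L⁻¹)`).  File 14's `n16_holder_of_leaf` at `g := gradConst 4 c` (leaf letters `(b, c)`; (Rb) for `b` from the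
numeral) ∘ file 17's `ne3Shape_of_covRootHolder`.  N16 ∕ NE3 NOT proved: the leaf clauses are node N05's theorems, (H3ˢᵘᵖ) is N07's. [folklore] -/
theorem ne3Shape_of_leaf_holder [Nonempty n] {L N : ℕ} (hL : 2 ≤ L) (hN : 1 ≤ N) :
    letI : CStarAlgebra (Matrix n n ℂ) := {}
    ∃ r : ℝ, 0 < r ∧
      ∀ (c₁ c₁' B₁' cP C₂ B₀β : ℝ) (inp : B8.B9Inputs) (len : Site 4 → ℝ), (∀ v : Site 4, 0 < len v → 1 ≤ len v) →
      (∀ μ : Fin 4, len (e μ) = 1) → 0 < B₁' → 5 * ((4 : ℕ) : ℝ) * L * inp.B₀ ≤ B₁' → 16 * (5 * ((4 : ℕ) : ℝ) * L * inp.B₀ * c₁') ≤ 1 →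
      (∀ α₀ α₁ : ℝ, 0 < α₀ → 0 < α₁ → α₀ + α₁ ≤ c₁' →
        α₀ + α₁ ≤ c₁ ∧ C0 4 * (2 * α₀) ≤ 1 / 3 ∧ 4 * α₀ ≤ c2' 4 L ∧ 16 * (B₁' * (α₀ + α₁)) ≤ 1 ∧
        Real.exp (4 * (800 * (((4 : ℕ) : ℝ) + 1) ^ 2 * (((4 : ℕ) : ℝ) + 4)) * α₀) *
            (1 + 8 * (131072 * (((4 : ℕ) : ℝ) + 1) ^ 2) * (B₁' * (α₀ + α₁))) ≤ 2 ∧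
        2 * (B₁' * (α₀ + α₁)) ≤ c3 4 L ∧ ((4 : ℕ) : ℝ) * L * α₁ ≤ 1 / 8 ∧ α₀ ≤ cP ∧ α₁ ≤ cP ∧ B₁' * (α₀ + α₁) ≤ cP ∧
        2 * (B₁' * (α₀ + α₁)) ^ 2 + 20 * ((4 : ℕ) : ℝ) * α₀ * (B₁' * (α₀ + α₁)) + 2 * C₂ * (B₁' * (α₀ + α₁)) ^ 2 ≤ α₀ + α₁) →
      ∀ ⦃ε s₁ t b c ε₁ : ℝ⦄, 0 < ε → ε ≤ r → 0 ≤ s₁ → s₁ ≤ r →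
      0 ≤ b → b ≤ t → 0 < c → c ≤ t →
      (2 : ℝ) ^ 91 * (L : ℝ) ^ 17 * t ≤ 1 → (2 : ℝ) ^ 76 * (L : ℝ) ^ 12 * t ≤ ε →
      16 * C0 4 * ε ≤ 3 → 1024 * (4 + 1) * (4 + 4) * (L : ℝ) ^ 2 * ε ≤ 1 → b ≤ ε / 2 →
      23040 * (4 : ℝ) ^ 4 * (frameC 4 L + 4) ^ 3 * (c + curConst 4 L * b ^ 2) ≤ 1 →
      ε₁ ≤ 1 / 4 → ε₁ ≤ b → 4 * ε₁ ≤ c →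
      ∀ ⦃α : ℝ⦄, 0 < α → ε < α → C0 4 * α ≤ 1 / 3 → 2 * α ≤ c2' 4 L → 11 * (4 : ℝ) ^ 2 * α ≤ 1 / 6 → α + 11 * (4 : ℝ) ^ 2 * α ≤ c₁' →
      b + 226 * (8 * ((4 : ℝ) + 1) * ((4 : ℝ) + 4)) ^ 2 * b ^ 2 < α → 4 * ((4 : ℝ) - 1) * (c + curConst 4 L * b ^ 2) < α →
      ∀ ⦃Mc : ℝ⦄, 0 ≤ Mc → (Mc + 1) * (b + 226 * (8 * ((4 : ℝ) + 1) * ((4 : ℝ) + 4)) ^ 2 * b ^ 2) ≤ 1 / 2 →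
      ∀ (𝒬 : ℕ → Set (Set (Site 4) × ℕ)), (∀ k, ∀ q ∈ 𝒬 k, q.2 ≤ k ∧ ∃ y : Site 4, ∀ z ∈ q.1, (l1 (z - y) : ℝ) ≤ Mc * (L : ℝ) ^ q.2) →
      ∀ ⦃C335 : ℝ⦄, 2 * (Mc + 1) * (b + 226 * (8 * ((4 : ℝ) + 1) * ((4 : ℝ) + 4)) ^ 2 * b ^ 2) + 2 * Mc * (2 * (c + curConst 4 L * b ^ 2)) +
        4 * Mc * (1 + 2 * Mc) * (b + 226 * (8 * ((4 : ℝ) + 1) * ((4 : ℝ) + 4)) ^ 2 * b ^ 2) ^ 2 < C335 →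
      ∀ ⦃s₂ : ℝ⦄,
      5 * ((4 : ℕ) : ℝ) * L * inp.B₀ * (α + 11 * (4 : ℝ) ^ 2 * α) ≤ s₁ →
      5 * ((4 : ℕ) : ℝ) * L * inp.B₀ * (α + 11 * (4 : ℝ) ^ 2 * α) +
          2 * (b + 226 * (8 * ((4 : ℝ) + 1) * ((4 : ℝ) + 4)) ^ 2 * b ^ 2) * s₁ ≤ s₁ →
      5 * ((4 : ℕ) : ℝ) * L * inp.B₀ * (α + 11 * (4 : ℝ) ^ 2 * α) + 16 * (b + 226 * (8 * ((4 : ℝ) + 1) * ((4 : ℝ) + 4)) ^ 2 * b ^ 2) *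
          (5 * ((4 : ℕ) : ℝ) * L * inp.B₀ * (α + 11 * (4 : ℝ) ^ 2 * α)) ≤ s₁ →
      5 * ((4 : ℕ) : ℝ) * L * B₀β * (α + 11 * (4 : ℝ) ^ 2 * α) + 8 * (b + 226 * (8 * ((4 : ℝ) + 1) * ((4 : ℝ) + 4)) ^ 2 * b ^ 2) *
          (5 * ((4 : ℕ) : ℝ) * L * inp.B₀ * (α + 11 * (4 : ℝ) ^ 2 * α)) ≤ s₂ →
      ∀ ⦃β : ℝ⦄, 0 ≤ β → β ≤ 1 →
      B8.Thm4Body c₁ B₁' (fun i : {i : ZdIdx 4 L // i.Ω 0 = Set.univ} => (zdGF3 (Matrix n n ℂ) L β len i.1).toGFData) →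
      B8.Prop3Body cP 4 (L : ℝ) C₂ inp B₀β (fun i : {i : ZdIdx 4 L // i.Ω 0 = Set.univ} => (zdGF3 (Matrix n n ℂ) L β len i.1).toGFData2) →
      ∀ {dom : _root_.Set (Site 4 → Fin 4 → (Matrix n n ℂ)ˣ)}, dom ⊆ sfClass 4 L N ε₁ 0 →
        LeafH3sup 4 L N ε b c dom →
        (∃ sel : ℕ → (Site 4 → Fin 4 → (Matrix n n ℂ)ˣ) → (Site 4 → Fin 4 → (Matrix n n ℂ)ˣ),
            ∀ V ∈ dom, ∀ k : ℕ, IsMinimiser 4 (sfClass 4 L N ε) L N k V (sel k V) ∧ RegularSup 4 L N b c k (sel k V)) ∧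
        ∀ sel : ℕ → (Site 4 → Fin 4 → (Matrix n n ℂ)ˣ) → (Site 4 → Fin 4 → (Matrix n n ℂ)ˣ),
          (∀ V ∈ dom, ∀ k : ℕ, IsMinimiser 4 (sfClass 4 L N ε) L N k V (sel k V)) →
          (∀ V ∈ dom, ∀ k : ℕ, RegularSup 4 L N b c k (sel k V)) →
          ∃ C' : ℝ, 0 ≤ C' ∧
            NE3Shape
              (minActReadings 4 (sfClass 4 L N ε) L N dom
                (fun k V (x : ↥(periodBox (d := 4) N)) =>
                  fineAction (sel k V) (((blockSites L)^[k] {(x : Site 4)}) ×ˢ Finset.univ)))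
              C' ((L : ℝ)⁻¹) := by
  letI : CStarAlgebra (Matrix n n ℂ) := {}
  obtain ⟨r, hr0, hr⟩ := n16_holder_of_leaf (n := n) hL hN
  refine ⟨r, hr0, fun c₁ c₁' B₁' cP C₂ B₀β inp len hlen hlen1 hB₁' hBB h16 hwin ε s₁ t b c ε₁ hε hεr hs₁ hs₁r hb hbt hc hct hsmall hεt hε1 hε2
    hbε hcF hε₁ hε₁b hε₁c α hα hεα hA3 hA2 hAs hAc hbα hcα Mc hMc hMcα 𝒬 h𝒬 C335 hC335 s₂ hss hgrad hℓ hhol β hβ0 hβ1 hT hP dom hdom h3 => ?_⟩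
  -- the regularity letter `g := gradConst 4 c > 0`; the β-root at `(b, gradConst 4 c)` from file 14 (leaf letters `(b′, c′) := (b, c)`)
  obtain ⟨C, hC0, hC⟩ := hr (gradConst_four_pos hc)
  -- (Rb) for `b` from the numeral `2^91·L^17·t ≤ 1` (n16-a's derivation, `…N16Thm4Print` §3)
  have hL1r : (1 : ℝ) ≤ L := by exact_mod_cast (show 1 ≤ L by omega)
  have hRb : 2 ^ 15 * ((4 : ℝ) + 1) ^ 2 * ((4 : ℝ) + 4) ^ 2 * (L : ℝ) ^ 2 * b ≤ 1 := by
    have h2 : (L : ℝ) ^ 2 ≤ (L : ℝ) ^ 17 := pow_le_pow_right₀ hL1r (by norm_num)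
    have e : 2 ^ 15 * ((4 : ℝ) + 1) ^ 2 * ((4 : ℝ) + 4) ^ 2 * (L : ℝ) ^ 2 * b = 52428800 * ((L : ℝ) ^ 2 * b) := by ring
    rw [e]
    have h5 : (L : ℝ) ^ 2 * b ≤ (L : ℝ) ^ 17 * t := mul_le_mul h2 hbt hb (by positivity)
    have h6 : (2 : ℝ) ^ 91 * ((L : ℝ) ^ 17 * t) ≤ 1 := by linarith [hsmall]
    have h7 : 0 ≤ (L : ℝ) ^ 17 * t := le_trans (by positivity) h5
    linarith [h5, h6, h7]
  have h16' := hC c₁ c₁' B₁' cP C₂ B₀β inp len hlen hlen1 hB₁' hBB h16 hwin hb hc.le hRb hcF hα hA3 hA2 hAs hAc hbα hcα hMc hMcα 𝒬 h𝒬 hC335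
    hε hεr hεα hs₁ hs₁r hb hbε hss hgrad hℓ hhol hβ0 hβ1 hT hP h3
  exact ne3Shape_of_covRootHolder hL hN hb hc.le hbt hct hC0 hsmall hεt hε1 hε2 hε₁ hε₁b hε₁c hdom h16' h3


/-! ## §2 The row's decl from N05's leaf of record SHAPE on `zdGF3 (M_n ℂ) L β len`, any `β ∈ [0,1]` -/

/-- **N16 · THE ROW's DECL `NE3Shape` FROM NODE N05's LEAF OF RECORD ON `zdGF3 (M_n(ℂ)) L β len` OVER THE UNIV SUB-INDEX AND N07's (H3ˢᵘᵖ)** (`d = 4`, `L ≥ 2`,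
`N ≥ 1`, ANY `β ∈ [0, 1]` — node N05's RESIDUAL Hölder exponent, printed «β ≦ β₀ < 1»): `∃ r > 0`, then for all `β ∈ [0,1]`, leaf parameters
`C₂ B₁′ B₀′ B₁ B₂ c₁ inp B₀β`, carriers `loc lan cub toAxial`, `len`, letters `0 < B₁′`, `5·4·L·B₀ ≤ B₁′`: the leaf `B8LeafRS 4 L C₂ B₁′ B₀′ B₁ B₂ c₁ inp B₀β loc
(fun i ↦ zdGF3 (M_n ℂ) L β len i.1) lan cub toAxial` yields a window threshold `c₁′ > 0` with `16·(5·4·L·B₀)·c₁′ ≤ 1` such that §1's tail holds verbatim, ending in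
`dom ⊆ sfClass 4 L N ε₁ 0 → LeafH3sup 4 L N ε b c dom → (selection) ∧ ∀ sel, ∃ C′ ≥ 0, NE3Shape … C′ (L⁻¹)`.  Only the leaf's `t4`, `p3` are read (g0's
`exists_window_print` below their thresholds).  THE N05 → N16 EDGE FOR THE ROW's DECL, BOTH ENDS IN THEIR OWNERS' CURRENCIES, AT THE PRINTED EXPONENT RANGE — no
restatement of any decl of record involved.  N16 ∕ NE3 NOT proved: the leaf is node N05's theorem, (H3ˢᵘᵖ) is N07's. [folklore] -/
theorem ne3Shape_of_b8LeafRS_holder [Nonempty n] {L N : ℕ} (hL : 2 ≤ L) (hN : 1 ≤ N) :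
    letI : CStarAlgebra (Matrix n n ℂ) := {}
    ∃ r : ℝ, 0 < r ∧
      ∀ {I₁ I₃ I₄ : Type} ⦃β : ℝ⦄, 0 ≤ β → β ≤ 1 → ∀ (C₂ B₁' B₀' B₁ B₂ c₁ : ℝ) (inp : B8.B9Inputs) (B₀β : ℝ) (loc : I₁ → B8.LocalData)
        (lan : I₃ → B8.LandauData) (cub : I₄ → B8.CubeData) (len : Site 4 → ℝ)
        (toAxial : ∀ i : {i : ZdIdx 4 L // i.Ω 0 = Set.univ},
          (zdGF3 (Matrix n n ℂ) L β len i.1).Cfg → (zdGF3 (Matrix n n ℂ) L β len i.1).Pert → (zdGF3 (Matrix n n ℂ) L β len i.1).Pert),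
      (∀ v : Site 4, 0 < len v → 1 ≤ len v) → (∀ μ : Fin 4, len (e μ) = 1) → 0 < B₁' → 5 * ((4 : ℕ) : ℝ) * L * inp.B₀ ≤ B₁' →
      B8LeafRS 4 (L : ℝ) C₂ B₁' B₀' B₁ B₂ c₁ inp B₀β loc
        (fun i : {i : ZdIdx 4 L // i.Ω 0 = Set.univ} => zdGF3 (Matrix n n ℂ) L β len i.1) lan cub toAxial →
      ∃ c₁' : ℝ, 0 < c₁' ∧ 16 * (5 * ((4 : ℕ) : ℝ) * L * inp.B₀ * c₁') ≤ 1 ∧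
      ∀ ⦃ε s₁ t b c ε₁ : ℝ⦄, 0 < ε → ε ≤ r → 0 ≤ s₁ → s₁ ≤ r →
      0 ≤ b → b ≤ t → 0 < c → c ≤ t →
      (2 : ℝ) ^ 91 * (L : ℝ) ^ 17 * t ≤ 1 → (2 : ℝ) ^ 76 * (L : ℝ) ^ 12 * t ≤ ε →
      16 * C0 4 * ε ≤ 3 → 1024 * (4 + 1) * (4 + 4) * (L : ℝ) ^ 2 * ε ≤ 1 → b ≤ ε / 2 →
      23040 * (4 : ℝ) ^ 4 * (frameC 4 L + 4) ^ 3 * (c + curConst 4 L * b ^ 2) ≤ 1 →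
      ε₁ ≤ 1 / 4 → ε₁ ≤ b → 4 * ε₁ ≤ c →
      ∀ ⦃α : ℝ⦄, 0 < α → ε < α → C0 4 * α ≤ 1 / 3 → 2 * α ≤ c2' 4 L → 11 * (4 : ℝ) ^ 2 * α ≤ 1 / 6 → α + 11 * (4 : ℝ) ^ 2 * α ≤ c₁' →
      b + 226 * (8 * ((4 : ℝ) + 1) * ((4 : ℝ) + 4)) ^ 2 * b ^ 2 < α → 4 * ((4 : ℝ) - 1) * (c + curConst 4 L * b ^ 2) < α →
      ∀ ⦃Mc : ℝ⦄, 0 ≤ Mc → (Mc + 1) * (b + 226 * (8 * ((4 : ℝ) + 1) * ((4 : ℝ) + 4)) ^ 2 * b ^ 2) ≤ 1 / 2 →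
      ∀ (𝒬 : ℕ → Set (Set (Site 4) × ℕ)), (∀ k, ∀ q ∈ 𝒬 k, q.2 ≤ k ∧ ∃ y : Site 4, ∀ z ∈ q.1, (l1 (z - y) : ℝ) ≤ Mc * (L : ℝ) ^ q.2) →
      ∀ ⦃C335 : ℝ⦄, 2 * (Mc + 1) * (b + 226 * (8 * ((4 : ℝ) + 1) * ((4 : ℝ) + 4)) ^ 2 * b ^ 2) + 2 * Mc * (2 * (c + curConst 4 L * b ^ 2)) +
        4 * Mc * (1 + 2 * Mc) * (b + 226 * (8 * ((4 : ℝ) + 1) * ((4 : ℝ) + 4)) ^ 2 * b ^ 2) ^ 2 < C335 →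
      ∀ ⦃s₂ : ℝ⦄,
      5 * ((4 : ℕ) : ℝ) * L * inp.B₀ * (α + 11 * (4 : ℝ) ^ 2 * α) ≤ s₁ →
      5 * ((4 : ℕ) : ℝ) * L * inp.B₀ * (α + 11 * (4 : ℝ) ^ 2 * α) +
          2 * (b + 226 * (8 * ((4 : ℝ) + 1) * ((4 : ℝ) + 4)) ^ 2 * b ^ 2) * s₁ ≤ s₁ →
      5 * ((4 : ℕ) : ℝ) * L * inp.B₀ * (α + 11 * (4 : ℝ) ^ 2 * α) + 16 * (b + 226 * (8 * ((4 : ℝ) + 1) * ((4 : ℝ) + 4)) ^ 2 * b ^ 2) *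
          (5 * ((4 : ℕ) : ℝ) * L * inp.B₀ * (α + 11 * (4 : ℝ) ^ 2 * α)) ≤ s₁ →
      5 * ((4 : ℕ) : ℝ) * L * B₀β * (α + 11 * (4 : ℝ) ^ 2 * α) + 8 * (b + 226 * (8 * ((4 : ℝ) + 1) * ((4 : ℝ) + 4)) ^ 2 * b ^ 2) *
          (5 * ((4 : ℕ) : ℝ) * L * inp.B₀ * (α + 11 * (4 : ℝ) ^ 2 * α)) ≤ s₂ →
      ∀ {dom : _root_.Set (Site 4 → Fin 4 → (Matrix n n ℂ)ˣ)}, dom ⊆ sfClass 4 L N ε₁ 0 →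
        LeafH3sup 4 L N ε b c dom →
        (∃ sel : ℕ → (Site 4 → Fin 4 → (Matrix n n ℂ)ˣ) → (Site 4 → Fin 4 → (Matrix n n ℂ)ˣ),
            ∀ V ∈ dom, ∀ k : ℕ, IsMinimiser 4 (sfClass 4 L N ε) L N k V (sel k V) ∧ RegularSup 4 L N b c k (sel k V)) ∧
        ∀ sel : ℕ → (Site 4 → Fin 4 → (Matrix n n ℂ)ˣ) → (Site 4 → Fin 4 → (Matrix n n ℂ)ˣ),
          (∀ V ∈ dom, ∀ k : ℕ, IsMinimiser 4 (sfClass 4 L N ε) L N k V (sel k V)) →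
          (∀ V ∈ dom, ∀ k : ℕ, RegularSup 4 L N b c k (sel k V)) →
          ∃ C' : ℝ, 0 ≤ C' ∧
            NE3Shape
              (minActReadings 4 (sfClass 4 L N ε) L N dom
                (fun k V (x : ↥(periodBox (d := 4) N)) =>
                  fineAction (sel k V) (((blockSites L)^[k] {(x : Site 4)}) ×ˢ Finset.univ)))
              C' ((L : ℝ)⁻¹) := by
  letI : CStarAlgebra (Matrix n n ℂ) := {}
  obtain ⟨r, hr0, hr⟩ := ne3Shape_of_leaf_holder (n := n) hL hN
  refine ⟨r, hr0, fun {I₁ I₃ I₄} β hβ0 hβ1 C₂ B₁' B₀' B₁ B₂ c₁ inp B₀β loc lan cub len toAxial hlen hlen1 hB₁' hBB leaf => ?_⟩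
  -- the two thresholds of the leaf's `t4` ∕ `p3`, and the window threshold below them (g0's file 6 verbatim)
  obtain ⟨c₁t, hc₁t, hT⟩ := leaf.t4
  obtain ⟨cP, hcP, hP⟩ := leaf.p3
  obtain ⟨c₁', hc₁', hwin⟩ := exists_window_print (d := 4) (L := L) (by norm_num) hL C₂ hc₁t hcP hB₁'
  have h16 : 16 * (5 * ((4 : ℕ) : ℝ) * L * inp.B₀ * c₁') ≤ 1 := by
    obtain ⟨-, -, -, h, -⟩ := hwin (c₁' / 2) (c₁' / 2) (by linarith) (by linarith) (by linarith)
    have h' : 16 * (B₁' * c₁') ≤ 1 := by rwa [add_halves] at h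
    nlinarith [mul_le_mul_of_nonneg_right hBB hc₁'.le]
  refine ⟨c₁', hc₁', h16, fun ε s₁ t b c ε₁ hε hεr hs₁ hs₁r hb hbt hc hct hsmall hεt hε1 hε2 hbε hcF hε₁ hε₁b hε₁c α hα hεα hA3 hA2 hAs hAc hbα hcα
    Mc hMc hMcα 𝒬 h𝒬 C335 hC335 s₂ hss hgrad hℓ hhol dom hdom h3 => ?_⟩
  exact hr c₁t c₁' B₁' cP C₂ B₀β inp len hlen hlen1 hB₁' hBB h16 hwin hε hεr hs₁ hs₁r hb hbt hc hct hsmall hεt hε1 hε2 hbε hcF hε₁ hε₁b hε₁c hα hεα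
    hA3 hA2 hAs hAc hbα hcα hMc hMcα 𝒬 h𝒬 hC335 hss hgrad hℓ hhol hβ0 hβ1 hT hP hdom h3


end Matrices

/-! ## §3 VACUITY GUARD: the β-root holds on the flat stratum for every `β ≤ 1`; file 17's `ne3Shape_of_covRootHolder` applies there -/

section Guard

variable {n : Type*} [Fintype n] [DecidableEq n]

/-- **THE β-ROOT ON THE FLAT STRATUM** (`L, N ≥ 1`, `0 ≤ ε`, `0 ≤ C, Λ₁, Λ₂′`, `β ≤ 1`): on `FS_N = {v N-periodic | ∃ w unitary, v = 1^{w}}` the covariant root of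
record holds with `Z = 0` (n16-a g0's `N16.n16_flatStratum`), hence the β-root for every `β ≤ 1` (`covRootHolder_of_ne3EnergyRateWCov`) — so no statement of the
β-column has an uninhabitable N16-side hypothesis. [folklore] -/
theorem covRootHolder_flatStratum [Nonempty n] {L N : ℕ} (hL : 1 ≤ L) (hN : 1 ≤ N) {ε : ℝ} (hε : 0 ≤ ε) (b g : ℝ) {C Λ₁ Λ₂' β : ℝ}
    (hC : 0 ≤ C) (hΛ₁ : 0 ≤ Λ₁) (hΛ₂' : 0 ≤ Λ₂') (hβ : β ≤ 1) :
    CovRootHolder 4 (sfClass 4 L N ε) L N b g C Λ₁ Λ₂' β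
      {v : Site 4 → Fin 4 → (Matrix n n ℂ)ˣ | IsPeriodicCfg v (N : ℤ) ∧ ∃ w : Site 4 → (Matrix n n ℂ)ˣ,
        IsUnitarySite w ∧ v = gaugeAct w flatCfg} :=
  covRootHolder_of_ne3EnergyRateWCov hL hβ hΛ₂' (n16_flatStratum hL hN hε b g hC hΛ₁ hΛ₂')

/-- **NO BINDER OF FILE 17's `ne3Shape_of_covRootHolder` IS VACUOUS — `NE3Shape` ON THE FLAT STRATUM THROUGH IT, ANY `β ≤ 1`** — n16-a's `N16.ne3Shape_flatStratum`
with `h16` the β-root (`covRootHolder_flatStratum`), the data class by `flatStratum_subset_sfClass_zero`, N07's interface by `leafH3sup_flatStratum`; numerals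
inhabited by `N16.shapeRegime_exists`. [folklore] -/
theorem ne3Shape_covRootHolder_flatStratum [Nonempty n] {L N : ℕ} (hL : 2 ≤ L) (hN : 1 ≤ N) {ε ε₁ b c t C Λ₁ Λ₂' β : ℝ}
    (hb : 0 ≤ b) (hc : 0 ≤ c) (hbt : b ≤ t) (hct : c ≤ t) (hC : 0 ≤ C) (hΛ₁ : 0 ≤ Λ₁) (hΛ₂' : 0 ≤ Λ₂') (hβ : β ≤ 1)
    (hsmall : (2 : ℝ) ^ 91 * (L : ℝ) ^ 17 * t ≤ 1) (hεt : (2 : ℝ) ^ 76 * (L : ℝ) ^ 12 * t ≤ ε)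
    (hε1 : 16 * C0 4 * ε ≤ 3) (hε2 : 1024 * (4 + 1) * (4 + 4) * (L : ℝ) ^ 2 * ε ≤ 1)
    (hε₁0 : 0 ≤ ε₁) (hε₁ : ε₁ ≤ 1 / 4) (hε₁b : ε₁ ≤ b) (hε₁c : 4 * ε₁ ≤ c) :
    (∃ sel : ℕ → (Site 4 → Fin 4 → (Matrix n n ℂ)ˣ) → (Site 4 → Fin 4 → (Matrix n n ℂ)ˣ),
        ∀ V ∈ {v : Site 4 → Fin 4 → (Matrix n n ℂ)ˣ | IsPeriodicCfg v (N : ℤ) ∧ ∃ w : Site 4 → (Matrix n n ℂ)ˣ,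
            IsUnitarySite w ∧ v = gaugeAct w flatCfg},
          ∀ k : ℕ, IsMinimiser 4 (sfClass 4 L N ε) L N k V (sel k V) ∧ RegularSup 4 L N b c k (sel k V)) ∧
    ∀ sel : ℕ → (Site 4 → Fin 4 → (Matrix n n ℂ)ˣ) → (Site 4 → Fin 4 → (Matrix n n ℂ)ˣ),
      (∀ V ∈ {v : Site 4 → Fin 4 → (Matrix n n ℂ)ˣ | IsPeriodicCfg v (N : ℤ) ∧ ∃ w : Site 4 → (Matrix n n ℂ)ˣ,
          IsUnitarySite w ∧ v = gaugeAct w flatCfg}, ∀ k : ℕ, IsMinimiser 4 (sfClass 4 L N ε) L N k V (sel k V)) →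
      (∀ V ∈ {v : Site 4 → Fin 4 → (Matrix n n ℂ)ˣ | IsPeriodicCfg v (N : ℤ) ∧ ∃ w : Site 4 → (Matrix n n ℂ)ˣ,
          IsUnitarySite w ∧ v = gaugeAct w flatCfg}, ∀ k : ℕ, RegularSup 4 L N b c k (sel k V)) →
      ∃ C' : ℝ, 0 ≤ C' ∧
        NE3Shape
          (minActReadings 4 (sfClass 4 L N ε) L N
            {v : Site 4 → Fin 4 → (Matrix n n ℂ)ˣ | IsPeriodicCfg v (N : ℤ) ∧ ∃ w : Site 4 → (Matrix n n ℂ)ˣ,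
              IsUnitarySite w ∧ v = gaugeAct w flatCfg}
            (fun k V (x : ↥(periodBox (d := 4) N)) =>
              fineAction (sel k V) (((blockSites L)^[k] {(x : Site 4)}) ×ˢ Finset.univ)))
          C' ((L : ℝ)⁻¹) := by
  have hL1 : 1 ≤ L := le_trans (by norm_num) hL
  have ht0 : 0 ≤ t := hb.trans hbt
  have hε0 : 0 ≤ ε := le_trans (by positivity) hεt
  exact ne3Shape_of_covRootHolder hL hN hb hc hbt hct hC hsmall hεt hε1 hε2 hε₁ hε₁b hε₁c (flatStratum_subset_sfClass_zero L N hε₁0)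
    (covRootHolder_flatStratum hL1 hN hε0 b (gradConst 4 c) hC hΛ₁ hΛ₂' hβ) (leafH3sup_flatStratum hL1 hN hε0 hb hc)

end Guard

end

end Summit.QuantumFields.YangMills.BalabanUVNodes.N16HolderShapeOfLeaf
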